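import Mathlib
import Literature.Algebra.Polynomial.ModularGcd
import Summits.ValiantsHypothesis.ValiantsHypothesis.Theorems.LacunarySymmetroidMatrixDescartesOsculationLawGPArcResultant

/-!
# `MatrixDescartes` (stmt-ValiantsHypothesis-18050), line `osculation_law`, stub `stub_recursion`, residue R6(a) —
# COPRIMALITY IS GENERIC ALONG A LINE: the transport engine for the two ARC-AVOIDANCE conditions of ROUTE′

Helper file (`--supports stmt-ValiantsHypothesis-18050 --as helper`; cell val-lit, seat val-port-3 g1, merged desk g12;
glue for the density theorem `gpNodeDensePrime` (7′b); the (a1)/(a2) transports named on the bus 12:13–12:28Z,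
val-lit-p7 g13's design l.8194).  Closes NO item.  Mathlib + tree `Literature.Algebra.Polynomial.ModularGcd`
(von zur Gathen–Gerhard Lemma 6.25, `map_resultant_eq_zero_iff_not_isCoprime`).  0 defs.

Arc avoidance at a node of the recursion says that the node curve `{Φ = 0}` has no osculation point ON the arc
`b = C·tᴺ`; substituting the arc, it says that the two real polynomials `f(t) = Φ(t, C tᴺ)` and
`g(t) = H(Φ)(t, C tᴺ)` have no common positive root, which follows from their COPRIMALITY.  Along a density segment
`S_ε` both are specialisations at `ε` of fixed bivariate polynomials `F, G ∈ ℝ[ε][t]`, and coprimality of the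
specialisations fails only where `lc_t(F)·Res_t(F, G) ∈ ℝ[ε]` vanishes — a nonzero polynomial as soon as ONE
parameter `ε₁` (the witness end) has `lc_t(F)(ε₁) ≠ 0` and coprime specialisations.

* **`finite_setOf_not_isCoprime_map`** — `F G : ℝ[X][X]`, one `ε₁` with `F.leadingCoeff.eval ε₁ ≠ 0` and
  `IsCoprime (F(ε₁,·)) (G(ε₁,·))` ⇒ `{ε | ¬ IsCoprime (F(ε,·)) (G(ε,·))}` is finite;
* (coprime real polynomials have no common root: tree `OsculationGeneric.not_isRoot_of_isCoprime`, val-lit-p7 g13);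
* **`finite_setOf_exists_common_root_map`** — under the same hypotheses, `{ε | ∃ t, F(ε,t) = 0 ∧ G(ε,t) = 0}` is
  finite (a fortiori the `ε` with a common POSITIVE root);
* `finite_setOf_exists_common_root_map₂` — the same for a conjunction with a side condition `P ε t` (e.g. `0 < t`).

[folklore] Resultants and specialisation.  Honest framing: glue; the arc-avoidance certificates at the witness, the
density (R6(a)), the osculation LAW, `MatrixDescartes` (18050) and VP ≠ VNP are NOT proved here.
-/

set_option linter.dupNamespace false

namespace Summit.ValiantsHypothesis.ValiantsHypothesis.Theorems.LacunarySymmetroidMatrixDescartes.GPDensity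

open Polynomial
open scoped Polynomial

/-- **Coprimality is generic along a line.**  For `F G ∈ ℝ[X][X]` (outer variable `t`, coefficients polynomial in
`ε`) and one parameter `ε₁` at which the `t`-leading coefficient of `F` does not vanish and the specialisations are
coprime, the set of `ε` with NON-coprime specialisations is finite (inside the zeros of `lc F · Res_t(F, G)`).
[folklore] -/
theorem finite_setOf_not_isCoprime_map (F G : ℝ[X][X]) (ε₁ : ℝ) (hlc : F.leadingCoeff.eval ε₁ ≠ 0)
    (hcop : IsCoprime (F.map (evalRingHom ε₁)) (G.map (evalRingHom ε₁))) :
    {ε : ℝ | ¬ IsCoprime (F.map (evalRingHom ε)) (G.map (evalRingHom ε))}.Finite := by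
  classical
  have hres1 : (resultant F G).eval ε₁ ≠ 0 := by
    intro h0
    have h := (Literature.Algebra.Polynomial.ModularGcd.map_resultant_eq_zero_iff_not_isCoprime
      (evalRingHom ε₁) F G (Or.inl (by simpa using hlc))).1 (by simpa using h0)
    exact h hcop
  have hlc0 : F.leadingCoeff ≠ 0 := fun h => hlc (by rw [h, eval_zero])
  have hres0 : resultant F G ≠ 0 := fun h => hres1 (by rw [h, eval_zero])
  refine (Polynomial.finite_setOf_isRoot (mul_ne_zero hlc0 hres0)).subset fun ε hε => ?_
  simp only [Set.mem_setOf_eq, IsRoot.def, eval_mul, mul_eq_zero] at hε ⊢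
  by_contra hgood
  push Not at hgood
  have hcopε := (Literature.Algebra.Polynomial.ModularGcd.map_resultant_eq_zero_iff_not_isCoprime
      (evalRingHom ε) F G (Or.inl (by simpa using hgood.1))).not.1 (by simpa using hgood.2)
  push Not at hcopε
  exact hε hcopε

/-- **Common roots are generic-ly absent along a line.**  Under the hypotheses of `finite_setOf_not_isCoprime_map`,
only finitely many `ε` admit a common root `t` of the two specialisations. [folklore] -/
theorem finite_setOf_exists_common_root_map (F G : ℝ[X][X]) (ε₁ : ℝ) (hlc : F.leadingCoeff.eval ε₁ ≠ 0)
    (hcop : IsCoprime (F.map (evalRingHom ε₁)) (G.map (evalRingHom ε₁))) :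
    {ε : ℝ | ∃ t : ℝ, (F.map (evalRingHom ε)).IsRoot t ∧ (G.map (evalRingHom ε)).IsRoot t}.Finite := by
  refine (finite_setOf_not_isCoprime_map F G ε₁ hlc hcop).subset fun ε hε => ?_
  simp only [Set.mem_setOf_eq] at hε ⊢
  obtain ⟨t, hF, hG⟩ := hε
  exact fun hc => OsculationGeneric.not_isRoot_of_isCoprime hc hF hG

/-- The same with an arbitrary side condition on the common root (e.g. `0 < t`), and the roots spelled by
`eval`. [folklore] -/
theorem finite_setOf_exists_common_root_map₂ (F G : ℝ[X][X]) (ε₁ : ℝ) (hlc : F.leadingCoeff.eval ε₁ ≠ 0)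
    (hcop : IsCoprime (F.map (evalRingHom ε₁)) (G.map (evalRingHom ε₁))) (P : ℝ → ℝ → Prop) :
    {ε : ℝ | ∃ t : ℝ, P ε t ∧ (F.map (evalRingHom ε)).eval t = 0 ∧ (G.map (evalRingHom ε)).eval t = 0}.Finite := by
  refine (finite_setOf_exists_common_root_map F G ε₁ hlc hcop).subset fun ε hε => ?_
  simp only [Set.mem_setOf_eq] at hε ⊢
  obtain ⟨t, -, hF, hG⟩ := hε
  exact ⟨t, hF, hG⟩

end Summit.ValiantsHypothesis.ValiantsHypothesis.Theorems.LacunarySymmetroidMatrixDescartes.GPDensity
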